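import Summits.BirchSwinnertonDyer.BirchSwinnertonDyer.Theorems.EisensteinPrimesB11DescentCertificate
import Summits.BirchSwinnertonDyer.BirchSwinnertonDyer.Theorems.EisensteinPrimesB11L3Cert1200o1
import HarnessLib

/-!
# Row B11 per pair, PREPRINT-FREE descent road — display `1200o1 @ 3` (split-GV; RULING L78 (3) desk-spot cell):
# `BSD(1200o1, 3)` from Gross–Zagier–Kolyvagin alone + the two READS (cell `bsd-eis`, seat `bsd-eis-k5-p4` g0; door
# `Theorems/EisensteinPrimesB11DescentCertificate.lean` p536512; THEOREMS ONLY — nothing booked)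

HONEST FRAMING (cell `bsd-eis`, run/shared/lean/pub/bsd-eis/; row B11 = X2c = `CellC`: `r_an = 1`, `p ‖ N`, `E[p]` reducible; crux 4
`BSDpOnCellC` stmt-BirchSwinnertonDyer-19034 OPEN; no label or count moves; BSD proved for no curve unconditionally; Mazur's main conjecture
is NOT concluded on this road — `BSDp` only). Table row `1200o @3` of `pub/bsd-eis/k5-p4-g0/B11-DESC3R1-TABLE-v1.tsv` (3ba341440843231c):
VERDICT `CERT`; record `1200o1 = [0, 1, 0, -13, 23]` (`N = 1200 = 2⁴·3·5²`), certifying kernel `x + 7`, `(s_φ̂, s_φ, m, EXCESS) = (1, 0, 1, 0)` on `isogchi` ‖ `isogcft`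
FIELD-IDENTICAL; `#Ш_an = 1` on every member of class `1200o` (Cremona `allbsd` = PARI leg), `r_an = 1` (Cremona; PARI `ellanalyticrank`).
**IN THE KERNEL:** `classX2_1200o1` (ellipticity, minimality, the sign at `3`, `E[3]` reducible) IMPORTED BY NAME from the cell's existing
display `Theorems/EisensteinPrimesB11L3Cert1200o1.lean` (k5-p3's L3 display) — not restated; the two roads meet at this pair. **READ (hypotheses; instrument data,
nothing asserted):** `hr : r_an = 1`, `hq`/`hv` : `#Ш_an = q` with `ord_3 q = 0`, `h : Ш[3] = 0` (EXCESS `= 0` on both isogeny-descent engines,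
kit j280759). **PUBLISHED fact BY NAME:** `hGZK` (Gross–Zagier–Kolyvagin, bsd.S17) — nothing else; no Iwasawa theory, no preprint, no `_OPEN` fact.
Refs: [Miller2011LMS] Def. 1.1; [SilvermanAEC2009] X.4.2; Cremona `ecdata` class 1200o.
-/

set_option autoImplicit false
set_option linter.dupNamespace false

noncomputable section

open scoped Classical

open WeierstrassCurve Literature.NumberTheory.EllipticCurves
  Literature.NumberTheory.EllipticCurves.Rank1Residual
  Literature.NumberTheory.EllipticCurves.Rank1Residual.Typed
  Summit.BirchSwinnertonDyer.Rank1Residual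
  Summit.BirchSwinnertonDyer.Rank1Residual.X2
  Summit.BirchSwinnertonDyer.BirchSwinnertonDyer.Theorems.B11L3Cert1200o1
  Summit.BirchSwinnertonDyer.BirchSwinnertonDyer.Theorems.B11DescentCertificate

namespace Summit.BirchSwinnertonDyer.BirchSwinnertonDyer.Theorems.B11Descent1200o1

/-- **X2c INSTANCE, DESCENT ROAD — `BSD(1200o1, 3)`** from Gross–Zagier–Kolyvagin (`hGZK`) and the two READS on `1200o1` (`#Ш_an` a `3`-adic
unit; `Ш[3] = 0` by the two isogeny-descent engines), through `X2.cellC_bsdp_of_shaAn_unit_of_noPTorsion`; `CellC 1200o1 3 = ⟨hr, classX2_1200o1⟩`.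
Nothing booked; `BSDp` only (no main-conjecture conjunct on this road). [cite: Miller2011LMS, §1 and Def. 1.1] -/
theorem bsdp_1200o1_at_three_of_descent (hGZK : rank_eq_analyticRank_of_analyticRank_le_one)
    (W : WeierstrassCurve ℚ) [W.IsElliptic] [W.IsGloballyMinimal] (hW : W = ⟨0, 1, 0, (-13), 23⟩)
    (hr : W.analyticRank = 1) {q : ℚ} (hq : shaAn W = (q : ℂ)) (hv : padicValRat 3 q = 0)
    (h : ∀ x : W.sha, (3 : ℤ) • x = 0 → x = 0) : BSDp W 3 := by
  subst hW
  exact X2.cellC_bsdp_of_shaAn_unit_of_noPTorsion _ 3 hGZK ⟨hr, classX2_1200o1⟩ hq hv h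

/-- **The same on the route's cell predicate**: `CellC 1200o1 3 → BSD(1200o1, 3)` modulo GZK and the two reads.
[cite: Miller2011LMS, §1 and Def. 1.1] -/
theorem targetC_1200o1_at_three_of_descent (hGZK : rank_eq_analyticRank_of_analyticRank_le_one)
    (W : WeierstrassCurve ℚ) [W.IsElliptic] [W.IsGloballyMinimal] (hW : W = ⟨0, 1, 0, (-13), 23⟩)
    {q : ℚ} (hq : shaAn W = (q : ℂ)) (hv : padicValRat 3 q = 0) (h : ∀ x : W.sha, (3 : ℤ) • x = 0 → x = 0) :
    CellC W 3 → BSDp W 3 :=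
  fun hc ↦ bsdp_1200o1_at_three_of_descent hGZK W hW hc.1 hq hv h

/-- **DECISION at the pair** (the «either way» of the road): under the descent read `Ш(1200o1)[3] = 0`, `BSD(1200o1, 3)` holds IF AND ONLY IF
the `#Ш_an` read has `3`-adic valuation `0` (`X2.cellC_bsdp_iff_padicValRat_shaAn_eq_zero_of_noPTorsion`). [cite: Miller2011LMS, §1 and Def. 1.1] -/
theorem bsdp_1200o1_at_three_iff_of_descent (hGZK : rank_eq_analyticRank_of_analyticRank_le_one)
    (W : WeierstrassCurve ℚ) [W.IsElliptic] [W.IsGloballyMinimal] (hW : W = ⟨0, 1, 0, (-13), 23⟩)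
    (hr : W.analyticRank = 1) (h : ∀ x : W.sha, (3 : ℤ) • x = 0 → x = 0) {q : ℚ} (hq : shaAn W = (q : ℂ)) :
    BSDp W 3 ↔ padicValRat 3 q = 0 := by
  subst hW
  exact X2.cellC_bsdp_iff_padicValRat_shaAn_eq_zero_of_noPTorsion _ 3 hGZK ⟨hr, classX2_1200o1⟩ h hq

end Summit.BirchSwinnertonDyer.BirchSwinnertonDyer.Theorems.B11Descent1200o1

end
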